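/- Fleet lead `ym-wcr-19456-p1` (seat g2), route `WeakCouplingRates`, crux `ColdBoxTwoPointFloorW` (stmt-QuantumFields-19608). -/
-- tree-module: Summits.QuantumFields.YangMills.Theorems.WeakCouplingRatesColdBoxTiltBound
import Summits.QuantumFields.YangMills.Theorems.WeakCouplingRatesColdBoxLinkSmall

/-!
# Crux `ColdBoxTwoPointFloorW`, stub `stub_boxGaussianDomination`, bricks R1+R3 assembled: on the small-field event the tilt exponent is
# uniformly small, `β·cost` is its quadratic surrogate up to `τ`, and `β·cost ≤ β^{2ε}`

With `δ = √(β^{2ε−1})`, `m = √2·(12H²+2H+1)·δ` (the sup-norm chart-coordinate bound of R1) and `τ = 362·β·m³` (the cubic remainder of R3),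
for every colour triple `t ∈ goodT H β ε` (i.e. `cfgT β H t ∈ coldGoodSet β ε H`), provided `m ≤ ¼`, `β > 0`, `H ≥ 1`:
* `sum_sq_extZero_unscaleT_le_of_mem_goodT` — every chart coordinate has `Σ_k w_e,k² ≤ m²`;
* `abs_beta_mul_plaqCostAt_sub_qObs_le_of_mem_goodT` — `|β·cost_p(cfgT t) − qObs p t| ≤ τ` for every plaquette `p`;
* `abs_tiltW_le_of_mem_goodT` — **`|tiltW β H t| ≤ #(plaquettesTouching Λ)·τ + 2·#(ColdFreeIdx H)·m²`** (cubic remainders + gnomonic Jacobian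
  `|log (1+s)⁻²| ≤ 2s`, `abs_log_gnomonicDensity_le`);
* `beta_mul_plaqCostAt_lt_of_mem_goodT` — `β·cost_p(cfgT t) < β^{2ε}` for plaquettes touching the box, and `centre_mem_plaquettesTouching` —
  the two plaquettes of `boxPlaqCov` touch the box (`T ≤ H`, `H ≥ 1`).
No sorry; no new definition; standard axioms.  NOT a claim about the mass gap.
-/

set_option autoImplicit false

noncomputable section

open Finset
open Literature.Probability.LatticeModels (Site)
open Literature.MathematicalPhysics.QuantumLattice
open Literature.MathematicalPhysics.QuantumFieldTheory
open Literature.MathematicalPhysics.QuantumFieldTheory.LatticeMaxwell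
open Literature.MathematicalPhysics.QuantumFieldTheory.AxialGauge

namespace Summit.QuantumFields.YangMills.Theorems.WeakCouplingRates

variable {H : ℕ}

/-- **R1 on `goodT`**: every chart coordinate of `unscaleT β H t` has `Σ_k w_e,k² ≤ m²`, `m = √2(12H²+2H+1)√(β^{2ε−1})`, provided `m ≤ ¼`. -/
theorem sum_sq_extZero_unscaleT_le_of_mem_goodT {β ε : ℝ} (hβ : 0 < β) (hH : 1 ≤ H)
    (hm : Real.sqrt 2 * ((12 * (H : ℝ) ^ 2 + 2 * H + 1) * Real.sqrt (β ^ (2 * ε - 1))) ≤ 1 / 4)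
    {t : TSpace H} (ht : t ∈ goodT H β ε) (e : Literature.MathematicalPhysics.QuantumLattice.ZdEdge 4) :
    ∑ k, extZero (unscaleT H β t) e k ^ 2 ≤ (Real.sqrt 2 * ((12 * (H : ℝ) ^ 2 + 2 * H + 1) * Real.sqrt (β ^ (2 * ε - 1)))) ^ 2 := by
  set η₀ : ℝ := (12 * (H : ℝ) ^ 2 + 2 * H + 1) * Real.sqrt (β ^ (2 * ε - 1)) with hη₀
  have hη₀0 : 0 ≤ η₀ := by positivity
  have h2 : Real.sqrt 2 ^ 2 = 2 := Real.sq_sqrt (by norm_num)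
  have hsmall : η₀ ^ 2 ≤ 1 / 2 := by
    have h1 : (Real.sqrt 2 * η₀) ^ 2 ≤ (1 / 4) ^ 2 := pow_le_pow_left₀ (by positivity) hm 2
    rw [mul_pow, h2] at h1
    linarith
  have hcost : ∀ p ∈ plaquettesTouching (boxEdges 4 (2 * H + 1)),
      plaqCostAt (fundamentalRep (Fin 2)) p.1 p.2.1.1 p.2.1.2 (chartCfg (unscaleT H β t)) < Real.sqrt (β ^ (2 * ε - 1)) ^ 2 := by
    rw [Real.sq_sqrt (Real.rpow_nonneg hβ.le _)]
    exact (chartCfg_mem_coldGoodSet_iff β ε _).1 ht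
  have key := sum_sq_extZero_le_of_plaqCost_lt hH (unscaleT H β t) (Real.sqrt_nonneg _) hsmall hcost e
  rw [mul_pow, h2]
  exact key

/-- **R3 on `goodT`**: `|β·cost_p(cfgT t) − qObs p t| ≤ τ = 362·β·m³` for every plaquette. -/
theorem abs_beta_mul_plaqCostAt_sub_qObs_le_of_mem_goodT {β ε : ℝ} (hβ : 0 < β) (hH : 1 ≤ H)
    (hm : Real.sqrt 2 * ((12 * (H : ℝ) ^ 2 + 2 * H + 1) * Real.sqrt (β ^ (2 * ε - 1))) ≤ 1 / 4)
    {t : TSpace H} (ht : t ∈ goodT H β ε) (x : Site 4) (i j : Fin 4) :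
    |β * plaqCostAt (fundamentalRep (Fin 2)) x i j (cfgT H β t) - qObs H (x, i, j) t| ≤
      362 * β * (Real.sqrt 2 * ((12 * (H : ℝ) ^ 2 + 2 * H + 1) * Real.sqrt (β ^ (2 * ε - 1)))) ^ 3 :=
  abs_beta_mul_plaqCostAt_cfgT_sub_qObs_le hβ t (by positivity) hm (sum_sq_extZero_unscaleT_le_of_mem_goodT hβ hH hm ht) x i j

/-- **The tilt exponent is uniformly small on `goodT`**: `|tiltW β H t| ≤ #(plaquettesTouching Λ)·τ + 2·#(ColdFreeIdx H)·m²`. -/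
theorem abs_tiltW_le_of_mem_goodT {β ε : ℝ} (hβ : 0 < β) (hH : 1 ≤ H)
    (hm : Real.sqrt 2 * ((12 * (H : ℝ) ^ 2 + 2 * H + 1) * Real.sqrt (β ^ (2 * ε - 1))) ≤ 1 / 4)
    {t : TSpace H} (ht : t ∈ goodT H β ε) :
    |tiltW H β t| ≤
      (#(plaquettesTouching (boxEdges 4 (2 * H + 1))) : ℝ) *
          (362 * β * (Real.sqrt 2 * ((12 * (H : ℝ) ^ 2 + 2 * H + 1) * Real.sqrt (β ^ (2 * ε - 1)))) ^ 3) +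
        2 * (Fintype.card (ColdFreeIdx H) : ℝ) * (Real.sqrt 2 * ((12 * (H : ℝ) ^ 2 + 2 * H + 1) * Real.sqrt (β ^ (2 * ε - 1)))) ^ 2 := by
  set m : ℝ := Real.sqrt 2 * ((12 * (H : ℝ) ^ 2 + 2 * H + 1) * Real.sqrt (β ^ (2 * ε - 1))) with hmdef
  set τ : ℝ := 362 * β * m ^ 3 with hτ
  rw [tiltW]
  refine (abs_add_le _ _).trans (add_le_add ?_ ?_)
  · -- plaquette terms
    refine (Finset.abs_sum_le_sum_abs _ _).trans ?_
    have hterm : ∀ q ∈ plaquettesTouching (boxEdges 4 (2 * H + 1)),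
        |qObs H (q.1, q.2.1.1, q.2.1.2) t - β * plaqCostAt (fundamentalRep (Fin 2)) q.1 q.2.1.1 q.2.1.2 (cfgT H β t)| ≤ τ := by
      intro q _
      rw [abs_sub_comm]
      exact abs_beta_mul_plaqCostAt_sub_qObs_le_of_mem_goodT hβ hH hm ht _ _ _
    calc ∑ q ∈ plaquettesTouching (boxEdges 4 (2 * H + 1)),
          |qObs H (q.1, q.2.1.1, q.2.1.2) t - β * plaqCostAt (fundamentalRep (Fin 2)) q.1 q.2.1.1 q.2.1.2 (cfgT H β t)|
        ≤ ∑ q ∈ plaquettesTouching (boxEdges 4 (2 * H + 1)), τ := Finset.sum_le_sum hterm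
      _ = _ := by rw [Finset.sum_const, nsmul_eq_mul]
  · -- Jacobian terms
    refine (Finset.abs_sum_le_sum_abs _ _).trans ?_
    have hterm : ∀ e : ColdFreeIdx H, |Real.log (((1 + ∑ i, (unscaleT H β t e i) ^ 2)⁻¹) ^ 2)| ≤ 2 * m ^ 2 := by
      intro e
      have hs0 : 0 ≤ ∑ i, (unscaleT H β t e i) ^ 2 := Finset.sum_nonneg fun i _ => sq_nonneg _
      have hle : ∑ i, (unscaleT H β t e i) ^ 2 ≤ m ^ 2 := by
        have := sum_sq_extZero_unscaleT_le_of_mem_goodT hβ hH hm ht e.1.1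
        simpa only [extZero_apply_free] using this
      calc |Real.log (((1 + ∑ i, (unscaleT H β t e i) ^ 2)⁻¹) ^ 2)| ≤ 2 * ∑ i, (unscaleT H β t e i) ^ 2 :=
            abs_log_gnomonicDensity_le hs0
        _ ≤ 2 * m ^ 2 := by linarith
    calc ∑ e : ColdFreeIdx H, |Real.log (((1 + ∑ i, (unscaleT H β t e i) ^ 2)⁻¹) ^ 2)| ≤ ∑ _e : ColdFreeIdx H, 2 * m ^ 2 :=
          Finset.sum_le_sum fun e _ => hterm e
      _ = _ := by rw [Finset.sum_const, nsmul_eq_mul, Finset.card_univ]; ring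

/-- On `goodT`, `β·cost_p(cfgT t) < β^{2ε}` for every plaquette touching the box (`β > 0`). -/
theorem beta_mul_plaqCostAt_lt_of_mem_goodT {β ε : ℝ} (hβ : 0 < β) {t : TSpace H} (ht : t ∈ goodT H β ε)
    {p : ZdPlaquette 4} (hp : p ∈ plaquettesTouching (boxEdges 4 (2 * H + 1))) :
    β * plaqCostAt (fundamentalRep (Fin 2)) p.1 p.2.1.1 p.2.1.2 (cfgT H β t) < β ^ (2 * ε) := by
  have h := (chartCfg_mem_coldGoodSet_iff β ε (unscaleT H β t)).1 ht p hp
  have hsplit : β ^ (2 * ε) = β * β ^ (2 * ε - 1) := by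
    rw [show (2 : ℝ) * ε = 1 + (2 * ε - 1) by ring, Real.rpow_add hβ, Real.rpow_one]
    ring_nf
  rw [hsplit]
  exact mul_lt_mul_of_pos_left h hβ

/-- On `goodT`, `0 ≤ β·cost_p(cfgT t) ≤ β^{2ε}` for every plaquette touching the box. -/
theorem beta_mul_plaqCostAt_mem_Icc_of_mem_goodT {β ε : ℝ} (hβ : 0 < β) {t : TSpace H} (ht : t ∈ goodT H β ε)
    {p : ZdPlaquette 4} (hp : p ∈ plaquettesTouching (boxEdges 4 (2 * H + 1))) :
    0 ≤ β * plaqCostAt (fundamentalRep (Fin 2)) p.1 p.2.1.1 p.2.1.2 (cfgT H β t) ∧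
      β * plaqCostAt (fundamentalRep (Fin 2)) p.1 p.2.1.1 p.2.1.2 (cfgT H β t) ≤ β ^ (2 * ε) :=
  ⟨mul_nonneg hβ.le (plaqCostAt_nonneg _ _ _ _), (beta_mul_plaqCostAt_lt_of_mem_goodT hβ ht hp).le⟩

/-- **The two plaquettes of `boxPlaqCov` touch the cold box**: for `H ≥ 1` and `T ≤ H`, the `(1,2)`-plaquettes at `boxCentre H` and at
`boxCentre H + T e₀` are in `plaquettesTouching (boxEdges 4 (2H+1))` (their edge `(x, 1)` lies in the box). -/
theorem centre_mem_plaquettesTouching (hH : 1 ≤ H) {T : ℕ} (hT : T ≤ H) :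
    ((boxCentre H, ⟨((1 : Fin 4), (2 : Fin 4)), by decide⟩) : ZdPlaquette 4) ∈ plaquettesTouching (boxEdges 4 (2 * H + 1)) ∧
      ((boxCentre H + Pi.single 0 (T : ℤ), ⟨((1 : Fin 4), (2 : Fin 4)), by decide⟩) : ZdPlaquette 4) ∈
        plaquettesTouching (boxEdges 4 (2 * H + 1)) := by
  have hedge : ∀ x : Site 4, (∀ k, 0 ≤ x k ∧ x k ≤ 2 * (H : ℤ)) → x 1 + 1 ≤ 2 * (H : ℤ) →
      ((x, ⟨((1 : Fin 4), (2 : Fin 4)), by decide⟩) : ZdPlaquette 4) ∈ plaquettesTouching (boxEdges 4 (2 * H + 1)) := by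
    intro x hx hx1
    rw [mem_plaquettesTouching_iff]
    refine ⟨(x, 1), Finset.mem_inter.2 ⟨by simp [plaquetteEdges], ?_⟩⟩
    rw [mem_boxEdges_iff]
    refine ⟨fun k => ⟨(hx k).1, by have := (hx k).2; push_cast; omega⟩, by push_cast; omega⟩
  have hH' : (1 : ℤ) ≤ H := by exact_mod_cast hH
  have hT' : (T : ℤ) ≤ H := by exact_mod_cast hT
  constructor
  · refine hedge _ (fun k => ?_) ?_
    · simp only [boxCentre]; constructor <;> omega
    · simp only [boxCentre]; omega
  · refine hedge _ (fun k => ?_) ?_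
    · by_cases hk : k = 0
      · subst hk; simp only [Pi.add_apply, boxCentre, Pi.single_eq_same]; constructor <;> omega
      · simp only [Pi.add_apply, boxCentre, Pi.single_eq_of_ne hk, add_zero]; constructor <;> omega
    · simp only [Pi.add_apply, boxCentre, Pi.single_eq_of_ne (show (1 : Fin 4) ≠ 0 by decide), add_zero]; omega

end Summit.QuantumFields.YangMills.Theorems.WeakCouplingRates

end
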